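import Literature.MathematicalPhysics.QuantumFieldTheory.Balaban1983to89.B8CubeMemberLamBPrimeLaws
import Literature.MathematicalPhysics.QuantumFieldTheory.Balaban1983to89.B8LeafKnitZd3CubBdryBeta
import Literature.MathematicalPhysics.QuantumFieldTheory.Balaban1983to89.B8Ineq159FlatDentedCubeMemberPrinted
import Literature.MathematicalPhysics.QuantumFieldTheory.Balaban1983to89.B8DentedCubeMemberZd
import Literature.MathematicalPhysics.QuantumFieldTheory.Balaban1983to89.B8Eq191FlatLettersCubeMember

/-!
# `Balaban1983to89.B8DentedCubeMemberLamBPrime` — [Balaban1985RegularSpaces] (1.31) p. 82 ∕ [Balaban1984PropagatorsII] (2.3) p. 224 ON THE DENTED TOWER OF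
# [Balaban1985Variational] (148)–(150): THE SPLIT CONSTRAINT-BOND CLASS `CubeB8D.lamBPT` AT EVERY TRUNCATION AND ITS THREE γ-DRIVER LAWS (box law «box ⊂ Ω′_{j−1}»,
# trichotomy w.r.t. the dented cells, boundary-layer law) — layer Lγ1 of the (β)∕(d3) road (twin of `B8CubeMemberLamBPrimeLaws` + `bdryLayer_cubeMember`)

statement-level skeleton of published theorems with citation tags; proofs where landed; nothing here is a claim about the
Yang–Mills mass gap

`[Balaban1985RegularSpaces]` ("B8" = [6], CMP **99** (1985) 75–102) (1.31) p. 82 («All sites of the contours Γ_{b₋,x} belong to Λ_{j−1}»), (1.5)–(1.6) p. 77, (1.68) p. 88, p. 98,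
(1.131) p. 99; `[Balaban1984PropagatorsII]` ("B6") (2.3) p. 224 (bonds of `Ω` = «at least one end-point of b belongs to Ω»); `[Balaban1985Variational]` ("[15]", CMP **102**
(1985) 277–309) p. 300, (148)–(150) p. 301, (153) p. 301 («R … defined for the sequence {Ω′_j}»).  PDF held: `paper:balaban1985-cmp99-regular-spaces-gauge-fixing`,
`paper:balaban1985-cmp102-variational-background` (pp. 24–25).

CITATION HEADER (lean-in-tree rule).  Cell `pub-ymgap` (YM Track A, HUMAN RULING D-0062), DAG node N05 = [B8], seat `pub-ymgap-dag-n05-e` (g31; FAN-OUT §N05 row s3b, Proposition-6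
lane; (β) road, dag-n05-c standing GO on dented twins I.42366).  WHY THIS FILE.  This seat's γ re-assembly of [6] Proposition 6 at a pure cube (`B8Prop6CubeMemberFlat3Gamma` →
… → `B8Prop6CubeMemberScalarGammaHolds`) runs the sequence-generic γ driver `B8Thm4ExistsAtGamma.thm4Exists_concrete_at_γ` at `(Ω, Λs, Λb) := (cubeFam false, cubeLamS,
cubeLamBP')` with THREE laws: the γ box law `B8CubeMemberLamBPrimeLaws.cubeLamBP'_hbox_pred` («box ⊂ □_{j−1}»), the trichotomy `cubeLamBP'_hclass` (inner ∕ crossing w.r.t.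
`cubeLamS`) and the boundary-layer law `B8LeafKnitZd3CubBdryBeta.bdryLayer_cubeMember`.  The dented road ((β): Proposition 6 on [15]'s local sequence `{Ω′_j}`, NODE 00's
`CubeB8D`) runs the same driver at `(c.sq, c.lamST, c.lamBPT)`; THIS FILE defines the dented split class at every truncation and proves the three laws for it.  Below the
top truncation everything IS the pure member's (`lamBPT_of_lt`); at `m = k` the class is dag-n06-b's split of print's dented class `CubeB8D.lamBP` (p659892): the DRIVER's
inner class `c.lamB k 0` at level `0`, `c.lamBP j` at `j ≥ 1`.  The one new geometric step is the dent case of the trichotomy: a level-`k` class bond with an end `b₊` in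
`□_k^{(k)}` whose `k`-block is NOT inside `Ω_k` is CROSSING — the `L`-block under `b₊` consists of level-`(k−1)` sites of the ENLARGED cell `Λ′_{k−1}`, because `Ω_k` is
`Lᵏ`-block saturated (`CubeB8D.blocks`): one fine site of the block outside `Ω_k` puts the whole block outside.

WHAT THIS MODULE PROVES (kernel, 0 sorry; `c : Node00.CubeB8D d L K Ω`, `1 ≤ L ≤ c.ρ`).
§1 `CubeB8D.lamBPT c m j` — the split class at truncation `m`: `cubeLamBP' L c.a c.M c.ρ c.k m j` for `m < k`; at `m ≥ k`: `c.lamB c.k 0` at `j = 0`, `c.lamBP j` at `j ≥ 1`;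
   `lamBPT_of_lt ∕ lamBPT_top_zero ∕ lamBPT_top_of_ne_zero`; `cubeLam_subset_lamS` (below the top the pure cell lies in the dented cell — equal for `j + 1 < k`, ENLARGED at
   `j = k − 1`); `mem_lamS_of_ends` (a non-deep site of `(Ω′_j)^{(j)}` is a dented cell).
§2 ★ `lamBPT_hbox_pred` — the γ box law for the dented class: the locality box of a level-`j` class bond lies in `Ω′_{j−1} = c.sq (j − 1)` (level `0`: in `Ω′₀`, the driver
   class's own law; `j ≥ 1`: dag-n05-c's `cubeLamBP_box_subset_pred` applied at the vacuous truncation `m := j`, and `□_{j−1} = Ω′_{j−1}` since `j − 1 < k`).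
§3 ★ `block_mem_lamS_pred_of_not_inTop` (the dent case) and ★★ `lamBPT_hclass` — the trichotomy for the dented class w.r.t. `c.lamST m`.
§4 ★ `bdryLayer_dented` — the boundary-layer law: a site of `Ω′₀ = □₀` with a sup-distance-1 neighbour outside lies in `c.lamST m 0` for `1 ≤ m ≤ k`.
HONEST SCOPE.  Set algebra on the dented tower; no estimate; nothing of [6]∕[15] asserted.  `ℤᵈ` carriers.  Count-neutral; N05 ∕ N07 NOT discharged; one finite `T⁴` programme at
fixed `ε`, Bałaban as printed; nothing continuum ∕ ℝ⁴ ∕ OS ∕ mass-gap ∕ Clay.  No `sorry`, no `instance`, no `notation`; one `def` (`lamBPT`).  Unit `pub-ymgap-dag-n05-e` (g31),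
2026-08-28.

RELATED IN THE TREE, NOT DUPLICATED: `B8CubeMemberLamBPrimeLaws.{cubeLamBP'_hbox_pred, cubeLamBP'_hclass, block_mem_cubeLamS_of_adjacent, mem_cubeLamS_of_inBox, sqLo_succ_blowup,
sqHi_succ_blowup}` (this seat g10; PURE member — USED), `B9SupplySockB9P3ZdGamma.cubeLamBP'` (dag-n06-b; the pure split class), `B8LeafKnitZd3CubBdryBeta.bdryLayer_cubeMember`
(this seat g8; USED), `B8Ineq159FlatDentedCubeMemberPrinted.CubeB8D.lamBP` (p659892; print's dented class — USED), `B8DentedCubeMemberZd.{CubeB8D.lamST, CubeB8D.lamB,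
inBox_sq_of_mem_lamS}` (this seat g31; USED), `Node00.CarriersB8CubeDented` (p655171; `CubeB8D`, `blocks`, `flm_eq_blockMap` — USED).
-/

noncomputable section

namespace Literature.MathematicalPhysics.QuantumFieldTheory.Balaban1983to89.B8DentedCubeMemberLamBPrime

open B7Prop1Explicit B7Prop1Local B8Ineq130
open B8Ineq132 (Under)
open B8Thm2LogB (blockTop)
open B8Eq131Cubes (cube sqLo sqHi inLo inHi flm under_flm)
open B8Eq131CubesAdmissible (cubeFam cubeFam_false_of_le cubeFam_false_zero)
open B8Eq131Derivation (under_zero_iff)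
open B8Ineq166Univ (under_add_of_under)
open B8CubeMemberZd (cubeLamS cubeLam cubeLamB cubeLamS_top under_smul_iff)
open B8Ineq159FlatCubeMemberPrinted (cubeLamBP cubeLamBP_box_subset_pred)
open B9SupplySockB9P3ZdGamma (cubeLamBP')
open B8CubeMemberLamBPrimeLaws (cubeLamBP'_hbox_pred cubeLamBP'_hclass block_mem_cubeLamS_of_adjacent sqLo_succ_blowup sqHi_succ_blowup)
open B8LeafKnitZd3CubBdryBeta (bdryLayer_cubeMember)
open B8Eq191FlatLettersCubeMember (under_smul_self)
open B8Ineq159FlatDentedCubeMemberPrinted (mem_lamBP_iff)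
open B8DentedCubeMemberZd (lamST_of_lt lamST_top hbox_lamB hclass_lamB inBox_sq_of_mem_lamS)
open Node00 (CubeB8D)
open Literature.MathematicalPhysics.QuantumLattice (blockMap)

-- `Site` alone could resolve to the torus sites of `Setup.lean`; re-export the `ℤ^d` sites of `B7Prop1Explicit`.
export B7Prop1Explicit (Site)

variable {d : ℕ}

/-! ## §0 Plumbing -/

/-- The floor map inverts `Under`: `x ∈ Bᵐ(z) ⇒ ⌊x∕Lᵐ⌋ = z` (private plumbing, as in the sibling modules). [folklore] -/
private theorem flm_eq_of_under {L : ℕ} (hL : 1 ≤ L) {m : ℕ} {z x : Site d} (hx : Under L m z x) : flm L m x = z := by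
  funext i
  obtain ⟨h1, h2⟩ := hx i
  have hL0 : (0 : ℤ) < (L : ℤ) := by exact_mod_cast hL
  have hpos : (0 : ℤ) < (L : ℤ) ^ m := pow_pos hL0 m
  simp only [flm]
  have hlo : z i ≤ x i / (L : ℤ) ^ m := Int.le_ediv_of_mul_le hpos (by linarith)
  have hhi : x i / (L : ℤ) ^ m < z i + 1 := Int.ediv_lt_of_lt_mul hpos (by linarith)
  omega

/-- `L•v ≤ x ≤ L•v + (L−1)𝟙` is `x ∈ B¹(v)` (the two spellings of the `L`-block under `v`). [cite: Balaban1985RegularSpaces, (1.6) p.77, (1.31) p.82] -/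
theorem under_one_of_block {L : ℕ} {v x : Site d} (hx1 : (L : ℤ) • v ≤ x) (hx2 : x ≤ (L : ℤ) • v + blockTop L) : Under L 1 v x := by
  intro i
  have h1 := hx1 i
  have h2 := hx2 i
  simp only [Pi.smul_apply, smul_eq_mul, Pi.add_apply, blockTop] at h1 h2
  rw [pow_one]
  constructor <;> linarith

/-! ## §1 The split class of the dented member at every truncation -/

section Class

variable {L K : ℕ} {Ω : ℕ → Set (Site d)}

/-- **THE SPLIT CONSTRAINT-BOND CLASS OF THE DENTED MEMBER AT TRUNCATION `m`** (edition γ: print's class with the level-`0` crossing bonds handled apart): for `m < k` the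
truncation only sees `Ω′_j = □_j`, so it IS dag-n06-b's `cubeLamBP' L c.a c.M c.ρ c.k m` (pure member); at the top (`m ≥ k`) it is the driver's INNER class `c.lamB c.k 0`
at level `0` and print's dented class `c.lamBP j` ([B6] (2.3) on `{Ω′_j}`, p659892) at `j ≥ 1`.
[cite: Balaban1985RegularSpaces, (1.31) p.82, (1.68) p.88; Balaban1984PropagatorsII, (2.3) p.224; Balaban1985Variational, (148)–(150) p.301, (153) p.301] -/
def _root_.Literature.MathematicalPhysics.QuantumFieldTheory.Balaban1983to89.Node00.CubeB8D.lamBPT (c : CubeB8D d L K Ω) (m j : ℕ) :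
    Set (Site d × Fin d) :=
  if m < c.k then cubeLamBP' L c.a c.M c.ρ c.k m j else if j = 0 then c.lamB c.k 0 else c.lamBP j

variable (c : CubeB8D d L K Ω)

/-- Below the top the split class is the pure member's. [cite: Balaban1985Variational, (150) p.301; Balaban1985RegularSpaces, (1.68) p.88] -/
theorem lamBPT_of_lt {m : ℕ} (hm : m < c.k) (j : ℕ) : c.lamBPT m j = cubeLamBP' L c.a c.M c.ρ c.k m j := by
  unfold CubeB8D.lamBPT; rw [if_pos hm]

/-- At the top, level `0`: the driver's inner class. [cite: Balaban1985RegularSpaces, (1.31) p.82] -/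
theorem lamBPT_top_zero : c.lamBPT c.k 0 = c.lamB c.k 0 := by
  unfold CubeB8D.lamBPT; rw [if_neg (lt_irrefl _), if_pos rfl]

/-- At the top, levels `j ≥ 1`: print's dented class. [cite: Balaban1984PropagatorsII, (2.3) p.224; Balaban1985Variational, (153) p.301] -/
theorem lamBPT_top_of_ne_zero {j : ℕ} (hj : j ≠ 0) : c.lamBPT c.k j = c.lamBP j := by
  unfold CubeB8D.lamBPT; rw [if_neg (lt_irrefl _), if_neg hj]

/-- **A NON-DEEP SITE OF `(Ω′_j)^{(j)}` IS A DENTED CELL**: the comprehension of `CubeB8D.lamS` read forwards (`j ≤ k`). [cite: Balaban1985Variational, (148) p.301; Balaban1985RegularSpaces, (1.5) p.77] -/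
theorem mem_lamS_of_ends {j : ℕ} (hj : j ≤ c.k) {z : Site d}
    (hE : InBox (sqLo L c.a c.ρ c.k j) (sqHi L c.a c.M c.ρ c.k j) z ∧ (j = c.k → ∀ x, Under L j z x → x ∈ Ω c.k))
    (hD : j < c.k → ¬ (InBox (inLo L c.a c.ρ c.k j) (inHi L c.a c.M c.ρ c.k j) z ∧ (j + 1 = c.k → ∀ x, Under L j z x → x ∈ Ω c.k))) :
    z ∈ c.lamS j := by
  simp only [Node00.CubeB8D.lamS, if_pos hj, Set.mem_setOf_eq]
  exact ⟨hE.1, hE.2, hD⟩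

/-- **BELOW THE TOP THE PURE CELL LIES IN THE DENTED CELL** (`j < k`): equal for `j + 1 < k`, and at `j = k − 1` the dented cell is [6]'s ENLARGED by the dent's labels.
[cite: Balaban1985Variational, (148)–(150) p.301; Balaban1985RegularSpaces, (1.5) p.77, (1.131) p.99] -/
theorem cubeLam_subset_lamS {j : ℕ} (hj : j < c.k) : cubeLam L c.a c.M c.ρ c.k j ⊆ c.lamS j := by
  intro z hz
  obtain ⟨hsq, hnin⟩ := hz
  exact mem_lamS_of_ends c hj.le ⟨hsq, fun h => absurd h (Nat.ne_of_lt hj)⟩ fun _ h => hnin hj h.1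

end Class

/-! ## §2 The γ box law «box ⊂ Ω′_{j−1}» for the dented split class -/

section Box

variable {L K : ℕ} {Ω : ℕ → Set (Site d)} (c : CubeB8D d L K Ω)

/-- ★ **THE γ BOX LAW FOR THE DENTED SPLIT CLASS**: for `m ≤ k`, `j ≤ m` and every class bond `b ∈ c.lamBPT m j`, the locality box `Bʲ(b₋) ∪ Bʲ(b₊)` lies in `Ω′_{j−1} =
c.sq (j − 1)` (Lean's `0 − 1 = 0`) — below the top the pure law; at the top: level `0` by the driver class's own law, `j ≥ 1` because an end lies in `(Ω′_j)^{(j)} ⊆ □_j^{(j)}`, so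
(dag-n05-c's `cubeLamBP_box_subset_pred`, `L ≤ ρ`) the box lies in `□_{j−1} = Ω′_{j−1}` (`j − 1 < k`).  VERBATIM the `hbox` binder of `thm4Exists_concrete_at_γ` at
`(Ω, Λb) := (c.sq, c.lamBPT)`. [cite: Balaban1985RegularSpaces, (1.31) p.82 («Γ_{b₋,x} ⊂ Λ_{j−1}»), (1.131) p.99; Balaban1984PropagatorsII, (2.3) p.224; Balaban1985Variational, (150) p.301] -/
theorem lamBPT_hbox_pred (hL : 1 ≤ L) :
    ∀ m, m ≤ c.k → ∀ j, j ≤ m → ∀ b ∈ c.lamBPT m j, ∀ x,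
      InBox (loK L j b.1) (bondHiK L j b.1 b.2) x → x ∈ c.sq (j - 1) := by
  intro m hm j hj b hb x hx
  have hρ : L ≤ c.ρ := c.L_le_ρ
  rcases lt_or_eq_of_le hm with hlt | heq
  · -- below the top: the pure law, and `□_{j−1} = Ω′_{j−1}`
    rw [lamBPT_of_lt c hlt] at hb
    have h := cubeLamBP'_hbox_pred hL c.a c.M hρ c.k m hm j hj b hb x hx
    rw [cubeFam_false_of_le L c.a c.M c.ρ (by omega : j - 1 ≤ c.k), ← c.sq_of_lt (by omega : j - 1 < c.k)] at h
    exact h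
  · subst heq
    rcases Nat.eq_zero_or_pos j with rfl | hj1
    · rw [lamBPT_top_zero] at hb
      exact hbox_lamB c c.k le_rfl 0 (Nat.zero_le _) b hb x hx
    · rw [lamBPT_top_of_ne_zero c (Nat.pos_iff_ne_zero.mp hj1), mem_lamBP_iff] at hb
      obtain ⟨-, hends, -⟩ := hb
      -- the bond, read at the vacuous truncation `m := j`, is in the pure class `cubeLamBP … j j`
      have hb' : b ∈ cubeLamBP L c.a c.M c.ρ c.k j j := by
        refine ⟨le_rfl, ?_, fun h => absurd h (lt_irrefl _)⟩
        rcases hends with h | h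
        · exact Or.inl h.1
        · exact Or.inr h.1
      rw [c.sq_of_lt (by omega : j - 1 < c.k)]
      exact cubeLamBP_box_subset_pred hL c.a c.M hρ hj1 (show j ≤ c.k from hj) hb' x hx

end Box

/-! ## §3 The trichotomy w.r.t. the dented cells -/

section Trichotomy

variable {L K : ℕ} {Ω : ℕ → Set (Site d)} (c : CubeB8D d L K Ω)

/-- ★ **THE DENT CASE**: if `b₊ ∈ □_k^{(k)}` but its `k`-block is NOT inside `Ω_k`, then every level-`(k−1)` site `x` of the `L`-block under `b₊` is a dented cell of level `k − 1`
(`x ∈ Λ′_{k−1}`): `x ∈ □_k^{(k−1)} ⊆ □_{k−1}^{(k−1)}` by the block arithmetic of the cubes (`ρ ≥ L ≥ 1`), and the `(k−1)`-block of `x` is NOT a block of `Ω_k` — it lies in the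
`k`-block of `b₊`, which is disjoint from `Ω_k` because `Ω_k` is `Lᵏ`-block saturated (`CubeB8D.blocks`) and one of its fine sites is outside. (`k ≥ 1`.)
[cite: Balaban1985Variational, (148)–(150) p.301; Balaban1985RegularSpaces, (1.3)–(1.6) p.77, p.98, (1.31) p.82] -/
theorem block_mem_lamS_pred_of_not_inTop (hL : 1 ≤ L) {w : Site d} (hw : InBox (sqLo L c.a c.ρ c.k c.k) (sqHi L c.a c.M c.ρ c.k c.k) w)
    (hnot : ¬ c.inTop w) :
    ∀ x, (L : ℤ) • w ≤ x → x ≤ (L : ℤ) • w + blockTop L → x ∈ c.lamS (c.k - 1) := by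
  intro x hx1 hx2
  have hk := c.one_le_k
  have hkk : c.k - 1 < c.k := by omega
  have hk1 : c.k - 1 + 1 = c.k := by omega
  have hLz : (0 : ℤ) < (L : ℤ) := by exact_mod_cast hL
  have hρz : (L : ℤ) ≤ (c.ρ : ℤ) := by exact_mod_cast c.L_le_ρ
  have hU1 : Under L 1 w x := under_one_of_block hx1 hx2
  have hx : ∀ i, (L : ℤ) * w i ≤ x i ∧ x i ≤ (L : ℤ) * w i + ((L : ℤ) - 1) := fun i => by
    have h1 := hx1 i
    have h2 := hx2 i
    simp only [Pi.smul_apply, smul_eq_mul, Pi.add_apply, blockTop] at h1 h2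
    exact ⟨h1, h2⟩
  rw [c.mem_lamS_pred_iff]
  constructor
  · -- `x ∈ □_{k−1}^{(k−1)}` (indeed in `□_k^{(k−1)}`, a collar `ρ ≥ L` inside)
    intro i
    obtain ⟨hw1, hw2⟩ := hw i
    obtain ⟨h1, h2⟩ := hx i
    have e1 := sqLo_succ_blowup (L := L) c.a c.ρ hkk i
    have e2 := sqHi_succ_blowup (L := L) c.a c.M c.ρ hkk i
    rw [hk1] at e1 e2
    constructor
    · nlinarith [mul_le_mul_of_nonneg_left hw1 hLz.le]
    · nlinarith [mul_le_mul_of_nonneg_left hw2 hLz.le]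
  · -- the `(k−1)`-block of `x` is not a block of `Ω_k`
    rintro ⟨-, hall⟩
    apply hnot
    -- one fine site under `x`, hence under `w`, in `Ω_k`
    have hy₀ : ((L : ℤ) ^ (c.k - 1)) • x ∈ Ω c.k := hall _ (under_smul_self hL (c.k - 1) x)
    have hUw : Under L c.k w (((L : ℤ) ^ (c.k - 1)) • x) := by
      have := under_add_of_under hU1 (under_smul_self hL (c.k - 1) x)
      rwa [Nat.add_comm, hk1] at this
    intro y hy
    -- `y` and the witness share the `k`-block `w`
    refine c.blocks ?_ hy₀
    rw [← Node00.CubeB8D.flm_eq_blockMap, ← Node00.CubeB8D.flm_eq_blockMap, flm_eq_of_under hL hUw, flm_eq_of_under hL hy]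

/-- ★★ **THE TRICHOTOMY LAW FOR THE DENTED SPLIT CLASS** w.r.t. the dented cells `c.lamST m` (`1 ≤ L ≤ ρ`): every class bond of `c.lamBPT m j` (`m ≤ k`, `j ≤ m`) is INNER (both
ends in `c.lamST m j`), CROSSING (`j = n + 1`, the `L`-block of `b₋` in `c.lamST m n`, `b₊ ∈ c.lamST m j`) or MIRRORED-CROSSING — VERBATIM the `hclass` binder of
`thm4Exists_concrete_at_γ` at `(Λs, Λb) := (c.lamST, c.lamBPT)`.  Below the top: the pure law.  At the top, level `0`: the driver class's own law; level `n + 1`: an end of the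
bond is a non-deep site of `(Ω′_{n+1})^{(n+1)}`, i.e. a dented cell; the other end is a dented cell too (INNER), or lies outside `□_{n+1}^{(n+1)}` (CROSSING, the pure block
step `block_mem_cubeLamS_of_adjacent` into the pure cell `Λ_n ⊆ Λ′_n`), or — the DENT case, `n + 1 = k` — lies in `□_k^{(k)}` with its `k`-block NOT inside `Ω_k` (CROSSING
into the enlarged `Λ′_{k−1}`, `block_mem_lamS_pred_of_not_inTop`).
[cite: Balaban1985RegularSpaces, (1.31) p.82 («All sites of the contours Γ_{b₋,x} belong to Λ_{j−1}»), (1.5) p.77, (1.131) p.99; Balaban1984PropagatorsII, (2.3) p.224; Balaban1985Variational, (148)–(150) p.301] -/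
theorem lamBPT_hclass (hL : 1 ≤ L) :
    ∀ m, m ≤ c.k → ∀ j, j ≤ m → ∀ b ∈ c.lamBPT m j,
      (b.1 ∈ c.lamST m j ∧ b.1 + e b.2 ∈ c.lamST m j) ∨
      (∃ j', j = j' + 1 ∧ (∀ x, (L : ℤ) • b.1 ≤ x → x ≤ (L : ℤ) • b.1 + blockTop L → x ∈ c.lamST m j') ∧ b.1 + e b.2 ∈ c.lamST m j) ∨
      (∃ j', j = j' + 1 ∧ b.1 ∈ c.lamST m j ∧
        (∀ x, (L : ℤ) • (b.1 + e b.2) ≤ x → x ≤ (L : ℤ) • (b.1 + e b.2) + blockTop L → x ∈ c.lamST m j')) := by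
  intro m hm j hj b hb
  have hρ : L ≤ c.ρ := c.L_le_ρ
  rcases lt_or_eq_of_le hm with hlt | heq
  · -- below the top: the pure law verbatim
    rw [lamBPT_of_lt c hlt] at hb
    rw [lamST_of_lt c hlt]
    exact cubeLamBP'_hclass hL c.a c.M hρ c.k m hm j hj b hb
  · subst heq
    rw [lamST_top c]
    rcases Nat.eq_zero_or_pos j with rfl | hj1
    · rw [lamBPT_top_zero] at hb
      have h := hclass_lamB c c.k le_rfl 0 (Nat.zero_le _) b hb
      rwa [lamST_top c] at h
    · obtain ⟨n, rfl⟩ : ∃ n, j = n + 1 := ⟨j - 1, by omega⟩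
      rw [lamBPT_top_of_ne_zero c (Nat.succ_ne_zero n), mem_lamBP_iff] at hb
      obtain ⟨-, hends, hdeep⟩ := hb
      have hnk : n < c.k := by omega
      -- adjacency of the two ends
      have hadj₁ : ∀ i, (b.1 + e b.2) i - 1 ≤ b.1 i ∧ b.1 i ≤ (b.1 + e b.2) i + 1 := by
        intro i
        simp only [Pi.add_apply, e, Pi.single_apply]
        split_ifs <;> constructor <;> omega
      have hadj₂ : ∀ i, b.1 i - 1 ≤ (b.1 + e b.2) i ∧ (b.1 + e b.2) i ≤ b.1 i + 1 := by
        intro i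
        simp only [Pi.add_apply, e, Pi.single_apply]
        split_ifs <;> constructor <;> omega
      -- the pure cell `Λ_n` lies in the dented cell `Λ′_n`
      have hsub : cubeLamS L c.a c.M c.ρ c.k c.k n ⊆ c.lamS n := by
        rw [cubeLamS_top L c.a c.M c.ρ hnk.le]; exact cubeLam_subset_lamS c hnk
      -- an end with property `E` is a dented cell (non-deepness from the class)
      have hcell : ∀ z : Site d, (InBox (sqLo L c.a c.ρ c.k (n + 1)) (sqHi L c.a c.M c.ρ c.k (n + 1)) z ∧
            (n + 1 = c.k → ∀ x, Under L (n + 1) z x → x ∈ Ω c.k)) →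
          (n + 1 < c.k → ¬ (InBox (inLo L c.a c.ρ c.k (n + 1)) (inHi L c.a c.M c.ρ c.k (n + 1)) z ∧
            (n + 1 + 1 = c.k → ∀ x, Under L (n + 1) z x → x ∈ Ω c.k))) → z ∈ c.lamS (n + 1) :=
        fun z hE hD => mem_lamS_of_ends c hj hE hD
      -- the block under an end WITHOUT property `E` lies in `Λ′_n`
      have hblock : ∀ v w : Site d, (InBox (sqLo L c.a c.ρ c.k (n + 1)) (sqHi L c.a c.M c.ρ c.k (n + 1)) w) →
          ¬ (InBox (sqLo L c.a c.ρ c.k (n + 1)) (sqHi L c.a c.M c.ρ c.k (n + 1)) v ∧ (n + 1 = c.k → ∀ x, Under L (n + 1) v x → x ∈ Ω c.k)) →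
          (∀ i, w i - 1 ≤ v i ∧ v i ≤ w i + 1) →
          ∀ x, (L : ℤ) • v ≤ x → x ≤ (L : ℤ) • v + blockTop L → x ∈ c.lamS n := by
        intro v w hw hv hadj x hx1 hx2
        by_cases hvsq : InBox (sqLo L c.a c.ρ c.k (n + 1)) (sqHi L c.a c.M c.ρ c.k (n + 1)) v
        · -- the DENT case: `v ∈ □_{n+1}^{(n+1)}`, so `n + 1 = k` and the `k`-block of `v` is not inside `Ω_k`
          have hnk' : n + 1 = c.k := by
            by_contra hne
            exact hv ⟨hvsq, fun h => absurd h hne⟩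
          have hn : n = c.k - 1 := by omega
          subst hn
          have hk1 : c.k - 1 + 1 = c.k := by omega
          rw [hk1] at hvsq hv
          have hnot : ¬ c.inTop v := fun h => hv ⟨hvsq, fun _ => h⟩
          exact block_mem_lamS_pred_of_not_inTop c hL hvsq hnot x hx1 hx2
        · exact hsub (block_mem_cubeLamS_of_adjacent hL c.a c.M hρ hj le_rfl hw hvsq hadj x hx1 hx2)
      by_cases hEm : InBox (sqLo L c.a c.ρ c.k (n + 1)) (sqHi L c.a c.M c.ρ c.k (n + 1)) b.1 ∧
          (n + 1 = c.k → ∀ x, Under L (n + 1) b.1 x → x ∈ Ω c.k)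
      · by_cases hEp : InBox (sqLo L c.a c.ρ c.k (n + 1)) (sqHi L c.a c.M c.ρ c.k (n + 1)) (b.1 + e b.2) ∧
            (n + 1 = c.k → ∀ x, Under L (n + 1) (b.1 + e b.2) x → x ∈ Ω c.k)
        · -- INNER
          exact Or.inl ⟨hcell _ hEm fun h => (hdeep h).1, hcell _ hEp fun h => (hdeep h).2⟩
        · -- MIRRORED-CROSSING: `b₋` a cell, `b₊` not
          exact Or.inr (Or.inr ⟨n, rfl, hcell _ hEm fun h => (hdeep h).1, hblock _ _ hEm.1 hEp hadj₂⟩)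
      · -- CROSSING: `b₋` not a cell-candidate, so `b₊` is
        have hEp : InBox (sqLo L c.a c.ρ c.k (n + 1)) (sqHi L c.a c.M c.ρ c.k (n + 1)) (b.1 + e b.2) ∧
            (n + 1 = c.k → ∀ x, Under L (n + 1) (b.1 + e b.2) x → x ∈ Ω c.k) := hends.resolve_left hEm
        exact Or.inr (Or.inl ⟨n, rfl, hblock _ _ hEp.1 hEm hadj₁, hcell _ hEp fun h => (hdeep h).2⟩)

end Trichotomy

/-! ## §4 The boundary-layer law of the dented member -/

section Layer

variable {L K : ℕ} {Ω : ℕ → Set (Site d)} (c : CubeB8D d L K Ω)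

/-- ★ **THE BOUNDARY-LAYER LAW FOR THE DENTED MEMBER**: a site of `Ω′₀ = □₀` with a sup-distance-`1` neighbour outside `□₀` lies in the level-`0` dented cell of every truncation
`1 ≤ m ≤ k` (`L ≥ 2`, `L ≤ ρ`): the pure law `bdryLayer_cubeMember` (the site is in `Λ₀ = □₀ ∖ □₁`, two collars away from any dent) and `Λ₀ ⊆ Λ′₀`.  VERBATIM the `hlay` binder of
`thm4Exists_concrete_at_γ` at `(Ω, Λs) := (c.sq, c.lamST)`. [cite: Balaban1985RegularSpaces, (1.5) p.77, p.98, (1.131) p.99; Balaban1985Variational, (150) p.301] -/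
theorem bdryLayer_dented (hL : 2 ≤ L) :
    ∀ m, 1 ≤ m → m ≤ c.k → ∀ y z : Site d, y ∈ c.sq 0 → z ∉ c.sq 0 →
      (∀ l, y l - 1 ≤ z l ∧ z l ≤ y l + 1) → y ∈ c.lamST m 0 := by
  intro m hm1 hmk y z hy hz hyz
  have hk := c.one_le_k
  rw [c.sq_zero, ← cubeFam_false_zero L c.a c.M c.ρ c.k] at hy hz
  have h := bdryLayer_cubeMember hL c.a c.M c.ρ c.k c.L_le_ρ hk m hm1 hmk y z hy hz hyz
  rcases lt_or_eq_of_le hmk with hlt | heq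
  · rw [lamST_of_lt c hlt]; exact h
  · subst heq
    rw [lamST_top c]
    rw [cubeLamS_top L c.a c.M c.ρ (Nat.zero_le _)] at h
    exact cubeLam_subset_lamS c hk h

end Layer

end Literature.MathematicalPhysics.QuantumFieldTheory.Balaban1983to89.B8DentedCubeMemberLamBPrime

end
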